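import Literature.NumberTheory.ModularForms.ModularCurveInvariantHeight
import Literature.Topology.CoveringSpaces.PunctureFill
import HarnessLib

/-!
# The compactification `X(Γ) = Γ∖ℍ ∪ {cusps}` of a finite-index subgroup of `SL₂(ℤ)`: the topology
# (Shimura §1.3–1.5; Diamond–Shurman §2.4)

Layer `Literature/NumberTheory/ModularForms`, namespace `Literature.NumberTheory.ModularForms.ModularCurve`;
sequel of `ModularCurveCuspFrames` / `ModularCurveInvariantHeight` (the chosen complete system of cusp frames
`σ_i = frame Γ i`, `i < h = numCusps Γ`, of a finite-index `Γ ≤ SL₂(ℤ)`, the sector lemma, and the continuous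
`Γ`-invariant height `y_Γ` with `y_Γ(σ_i w) = Im w` on the sectors). G. Shimura, *Introduction to the arithmetic
theory of automorphic functions* (1971) §1.3–§1.5 topologises `ℍ* = ℍ ∪ {cusps}` by the horoball neighbourhoods
`{s} ∪ {Im σ⁻¹z > T}` of a cusp `s = σ∞` and shows (Thm. 1.28, Prop. 1.29–1.31) that `Γ∖ℍ*` is a compact Hausdorff
space, locally a disc at each cusp via `z ↦ exp(2πi σ⁻¹z/h)`; F. Diamond, J. Shurman, GTM 228, §2.4 likewise.

We build `X(Γ)` DIRECTLY as the tree's `PunctureFill` of the open curve `Y(Γ) = Γ∖ℍ` (Mathlib's orbit space of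
the image of `Γ` in `GL₂(ℝ)` acting on `ℍ`): one new point `cuspPt i` per cusp class, attached at the end of the
cusp sector `sector Γ i = π(σ_i{Im > 1})` along the «cusp depth» `exp(−y_Γ)`, which tends to `0` exactly into the
cusps. This gives at once the topology, the open embedding `inl : Y(Γ) → X(Γ)` with finite complement, and the
neighbourhood filter of a cusp (`nhds_cuspPt_hasBasis`: the sets `{cuspPt i} ∪ π(σ_i{Im > T})`, `T ≥ 1`, i.e.
Shimura's horoball neighbourhoods).

* `Quot Γ = Γ∖ℍ`, `proj`, `heightQ` (the height on the quotient, continuous), `depth = exp(−heightQ)`,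
  `sector Γ i` (open), `Cpt Γ = X(Γ)`, `inl`, `cuspPt`, `cuspNhd i T`;
* `isOpenEmbedding_inl`, `compl_range_inl`, `dense_range_inl`;
* `nhds_cuspPt_hasBasis`, `continuousAt_cuspPt_iff` (a map out of `X(Γ)` is continuous at `cuspPt i` iff along
  `w ↦ π(σ_i w)` it tends to its value as `Im w → ∞`);
* `instT2Space` — **`X(Γ)` is Hausdorff** (sectors of distinct cusps are disjoint by the sector lemma; a point of
  `Y(Γ)` of height `< T` is separated from `cuspPt i` by `{y_Γ < T}` and `cuspNhd i T`);
* `instConnectedSpace` — `X(Γ)` is connected (`Y(Γ)` is, and is dense).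

Compactness and the cusp charts are the sequel `ModularCurveCuspCharts`. Everything is proved; the definitions
are the displayed data; two instances (`T2Space`, `ConnectedSpace`) on the new type `Cpt Γ` only.

## References

* G. Shimura, *Introduction to the arithmetic theory of automorphic functions* (1971), §1.3 (Prop. 1.17, Lemma 1.20),
  §1.5 (Thm. 1.28, Prop. 1.29–1.31). [ShimuraIATAF1971]
* F. Diamond, J. Shurman, *A first course in modular forms*, GTM 228 (2005), §2.4 (Prop. 2.4.2, Cor. 2.4.3,
  Prop. 2.4.4). [DiamondShurman2005]
-/

noncomputable section

open scoped MatrixGroups Pointwise Topology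
open Set Filter Function UpperHalfPlane
open Literature.Topology.CoveringSpaces

namespace Literature.NumberTheory.ModularForms

namespace ModularCurve

variable (Γ : Subgroup SL(2, ℤ)) [Γ.FiniteIndex]

/-! ### The open curve `Y(Γ) = Γ∖ℍ`, the height on it and the cusp sectors -/

omit [Γ.FiniteIndex] in
/-- **The open modular curve `Y(Γ) = Γ∖ℍ`** (Mathlib's orbit space of the image of `Γ` in `GL₂(ℝ)` acting on `ℍ`,
with the quotient topology). [cite: DiamondShurman2005, §2.1] -/
abbrev Quot : Type := MulAction.orbitRel.Quotient (Γ : Subgroup (GL (Fin 2) ℝ)) ℍ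

omit [Γ.FiniteIndex] in
/-- The projection `π : ℍ → Y(Γ)`. [cite: DiamondShurman2005, §2.1] -/
abbrev proj : ℍ → Quot Γ := Quotient.mk _

omit [Γ.FiniteIndex] in
/-- `π(γz) = π(z)`. [cite: DiamondShurman2005, §2.1] -/
theorem proj_smul {γ : GL (Fin 2) ℝ} (hγ : γ ∈ (Γ : Subgroup (GL (Fin 2) ℝ))) (z : ℍ) : proj Γ (γ • z) = proj Γ z :=
  Quotient.sound ⟨⟨γ, hγ⟩, rfl⟩

omit [Γ.FiniteIndex] in
/-- `π z = π z'` iff `z' = γ z` for some `γ ∈ Γ`. [cite: DiamondShurman2005, §2.1] -/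
theorem proj_eq_iff {z z' : ℍ} : proj Γ z = proj Γ z' ↔ ∃ γ ∈ (Γ : Subgroup (GL (Fin 2) ℝ)), γ • z' = z := by
  rw [Quotient.eq]
  change (∃ g : (Γ : Subgroup (GL (Fin 2) ℝ)), g • z' = z) ↔ _
  exact ⟨fun ⟨g, hg⟩ => ⟨g, g.2, hg⟩, fun ⟨γ, hγ, h⟩ => ⟨⟨γ, hγ⟩, h⟩⟩

omit [Γ.FiniteIndex] in
/-- `π` is an open quotient map. [cite: DiamondShurman2005, §2.1] -/
theorem isOpenQuotientMap_proj : IsOpenQuotientMap (proj Γ) :=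
  MulAction.isOpenQuotientMap_quotientMk

omit [Γ.FiniteIndex] in
/-- `π` is an open map. [cite: DiamondShurman2005, §2.1] -/
theorem isOpenMap_proj : IsOpenMap (proj Γ) := (isOpenQuotientMap_proj Γ).isOpenMap

omit [Γ.FiniteIndex] in
/-- `π` is continuous. [cite: DiamondShurman2005, §2.1] -/
theorem continuous_proj : Continuous (proj Γ) := continuous_quotient_mk'

omit [Γ.FiniteIndex] in
/-- `π` is surjective. [cite: DiamondShurman2005, §2.1] -/
theorem proj_surjective : Surjective (proj Γ) := Quotient.mk_surjective

/-- **The height on `Y(Γ)`**: `y_Γ` descends along `π` (it is `Γ`-invariant). [cite: ShimuraIATAF1971, §1.5] -/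
def heightQ : Quot Γ → ℝ :=
  Quotient.lift (height Γ) (by rintro a b ⟨γ, rfl⟩; exact height_smul Γ γ.2 b)

/-- `heightQ (π z) = y_Γ(z)`. [cite: ShimuraIATAF1971, §1.5] -/
@[simp] theorem heightQ_proj (z : ℍ) : heightQ Γ (proj Γ z) = height Γ z := rfl

/-- The height on `Y(Γ)` is continuous. [cite: ShimuraIATAF1971, §1.5] -/
theorem continuous_heightQ : Continuous (heightQ Γ) :=
  (continuous_height Γ).quotient_lift _

/-- The height on `Y(Γ)` is positive. [cite: ShimuraIATAF1971, §1.5] -/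
theorem heightQ_pos (y : Quot Γ) : 0 < heightQ Γ y := by
  obtain ⟨z, rfl⟩ := proj_surjective Γ y
  exact height_pos Γ z

/-- **The cusp depth** `exp(−y_Γ)`: positive, continuous, and `→ 0` exactly into the cusps. [cite: ShimuraIATAF1971, §1.5] -/
def depth : Quot Γ → ℝ := fun y => Real.exp (-heightQ Γ y)

/-- The cusp depth is continuous. [cite: ShimuraIATAF1971, §1.5] -/
theorem continuous_depth : Continuous (depth Γ) :=
  Real.continuous_exp.comp (continuous_heightQ Γ).neg

/-- The cusp depth never vanishes. [cite: ShimuraIATAF1971, §1.5] -/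
theorem depth_ne_zero (y : Quot Γ) : depth Γ y ≠ 0 := (Real.exp_pos _).ne'

/-- **The cusp sector** `π(σ_i{Im > 1}) ⊆ Y(Γ)` of the `i`-th cusp. [cite: ShimuraIATAF1971, §1.5 Thm. 1.28] -/
def sector (i : Fin (numCusps Γ)) : Set (Quot Γ) := proj Γ '' (frameGL Γ i • {w : ℍ | 1 < w.im})

/-- The horoball `σ_i{Im > T}` is open. [cite: ShimuraIATAF1971, §1.3] -/
theorem isOpen_frameGL_smul_setOf_lt (i : Fin (numCusps Γ)) (T : ℝ) : IsOpen (frameGL Γ i • {w : ℍ | T < w.im}) :=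
  (isOpen_lt continuous_const UpperHalfPlane.continuous_im).smul _

/-- The cusp sectors are open. [cite: ShimuraIATAF1971, §1.5 Thm. 1.28] -/
theorem isOpen_sector (i : Fin (numCusps Γ)) : IsOpen (sector Γ i) :=
  isOpenMap_proj Γ _ (isOpen_frameGL_smul_setOf_lt Γ i 1)

/-- Membership in the image of a horoball: `y ∈ π(σ_i{Im > T})` iff `y = π(σ_i w)` with `Im w > T`.
[cite: ShimuraIATAF1971, §1.5] -/
theorem mem_proj_image_iff {i : Fin (numCusps Γ)} {T : ℝ} {y : Quot Γ} :
    y ∈ proj Γ '' (frameGL Γ i • {w : ℍ | T < w.im}) ↔ ∃ w : ℍ, T < w.im ∧ proj Γ (frameGL Γ i • w) = y := by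
  constructor
  · rintro ⟨_, ⟨w, hw, rfl⟩, rfl⟩
    exact ⟨w, hw, rfl⟩
  · rintro ⟨w, hw, rfl⟩
    exact ⟨_, ⟨w, hw, rfl⟩, rfl⟩

/-- The depth on a sector: `depth (π(σ_i w)) = exp(−Im w)` for `Im w ≥ 1`. [cite: ShimuraIATAF1971, §1.5] -/
theorem depth_proj_frameGL_smul (i : Fin (numCusps Γ)) {w : ℍ} (hw : 1 ≤ w.im) :
    depth Γ (proj Γ (frameGL Γ i • w)) = Real.exp (-w.im) := by
  rw [depth, heightQ_proj, height_frameGL_smul Γ i hw]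

/-- **The deep part of a sector is a smaller horoball**: for `T ≥ 1`,
`sector i ∩ {depth < e^{−T}} = π(σ_i{Im > T})`. [cite: ShimuraIATAF1971, §1.5 Thm. 1.28] -/
theorem sector_inter_depth_lt (i : Fin (numCusps Γ)) {T : ℝ} (hT : 1 ≤ T) :
    sector Γ i ∩ depth Γ ⁻¹' Iio (Real.exp (-T)) = proj Γ '' (frameGL Γ i • {w : ℍ | T < w.im}) := by
  ext y
  rw [mem_inter_iff, sector, mem_proj_image_iff, mem_proj_image_iff, mem_preimage, mem_Iio]
  constructor
  · rintro ⟨⟨w, hw, rfl⟩, hd⟩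
    rw [depth_proj_frameGL_smul Γ i hw.le, Real.exp_lt_exp, neg_lt_neg_iff] at hd
    exact ⟨w, hd, rfl⟩
  · rintro ⟨w, hw, rfl⟩
    refine ⟨⟨w, lt_of_le_of_lt hT hw, rfl⟩, ?_⟩
    rw [depth_proj_frameGL_smul Γ i (hT.trans hw.le), Real.exp_lt_exp, neg_lt_neg_iff]
    exact hw

/-! ### The compactification `X(Γ)` -/

/-- **THE COMPACTIFIED MODULAR CURVE `X(Γ) = Γ∖ℍ ∪ {cusps}`**: the tree's `PunctureFill` of `Y(Γ)` along the
cusp depth at `0`, one new point per cusp class, attached at the end of its sector.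
[cite: ShimuraIATAF1971, §1.5 Thm. 1.28] [cite: DiamondShurman2005, §2.4] -/
abbrev Cpt : Type := PunctureFill (depth Γ) (0 : ℝ) (sector Γ)

/-- The points of the open curve inside `X(Γ)`. [cite: DiamondShurman2005, §2.4] -/
def inl : Quot Γ → Cpt Γ := PunctureFill.inl (depth Γ) 0 (sector Γ)

/-- **The cusps of `X(Γ)`**, indexed by the chosen complete system `i < numCusps Γ`. [cite: DiamondShurman2005, §2.4] -/
def cuspPt (i : Fin (numCusps Γ)) : Cpt Γ := PunctureFill.inr (depth Γ) 0 (sector Γ) i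

/-- `inl` is injective. [cite: DiamondShurman2005, §2.4] -/
theorem inl_injective : Injective (inl Γ) := PunctureFill.inl_injective _ _ _

/-- `cuspPt` is injective. [cite: DiamondShurman2005, §2.4] -/
theorem cuspPt_injective : Injective (cuspPt Γ) := PunctureFill.inr_injective _ _ _

/-- Old points are not cusps. [cite: DiamondShurman2005, §2.4] -/
theorem inl_ne_cuspPt (y : Quot Γ) (i : Fin (numCusps Γ)) : inl Γ y ≠ cuspPt Γ i := PunctureFill.inl_ne_inr _ _ _ y i

/-- Every point of `X(Γ)` is an old point or a cusp. [cite: DiamondShurman2005, §2.4] -/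
theorem inl_or_cuspPt (x : Cpt Γ) : (∃ y, x = inl Γ y) ∨ ∃ i, x = cuspPt Γ i := PunctureFill.inl_or_inr _ _ _ x

/-- **`Y(Γ) ↪ X(Γ)` is an open embedding.** [cite: DiamondShurman2005, §2.4 Prop. 2.4.2] -/
theorem isOpenEmbedding_inl : Topology.IsOpenEmbedding (inl Γ) :=
  PunctureFill.isOpenEmbedding_inl (continuous_depth Γ) (isOpen_sector Γ)

/-- `inl` is continuous. [cite: DiamondShurman2005, §2.4] -/
theorem continuous_inl : Continuous (inl Γ) := (isOpenEmbedding_inl Γ).continuous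

/-- The range of `inl` is open. [cite: DiamondShurman2005, §2.4] -/
theorem isOpen_range_inl : IsOpen (range (inl Γ)) := (isOpenEmbedding_inl Γ).isOpen_range

/-- The complement of `Y(Γ)` in `X(Γ)` is the finite set of cusps. [cite: DiamondShurman2005, §2.4] -/
theorem compl_range_inl : (range (inl Γ))ᶜ = range (cuspPt Γ) := by
  ext x
  rcases inl_or_cuspPt Γ x with ⟨y, rfl⟩ | ⟨i, rfl⟩
  · simp only [mem_compl_iff, mem_range_self, not_true_eq_false, mem_range, false_iff, not_exists]
    exact fun i h => inl_ne_cuspPt Γ y i h.symm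
  · simp only [mem_compl_iff, mem_range, not_exists, exists_apply_eq_apply, iff_true]
    exact fun y h => inl_ne_cuspPt Γ y i h

/-! ### The neighbourhoods of a cusp -/

/-- **The horoball neighbourhoods of a cusp**: `{cuspPt i} ∪ π(σ_i{Im > T})`. [cite: ShimuraIATAF1971, §1.3 and §1.5 Thm. 1.28] -/
def cuspNhd (i : Fin (numCusps Γ)) (T : ℝ) : Set (Cpt Γ) :=
  insert (cuspPt Γ i) (inl Γ '' (proj Γ '' (frameGL Γ i • {w : ℍ | T < w.im})))

/-- The cusp lies in its neighbourhoods. [cite: ShimuraIATAF1971, §1.5] -/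
theorem cuspPt_mem_cuspNhd (i : Fin (numCusps Γ)) (T : ℝ) : cuspPt Γ i ∈ cuspNhd Γ i T := mem_insert _ _

/-- Membership of an old point in a cusp neighbourhood. [cite: ShimuraIATAF1971, §1.5] -/
theorem inl_mem_cuspNhd_iff {i : Fin (numCusps Γ)} {T : ℝ} {y : Quot Γ} :
    inl Γ y ∈ cuspNhd Γ i T ↔ ∃ w : ℍ, T < w.im ∧ proj Γ (frameGL Γ i • w) = y := by
  rw [cuspNhd, mem_insert_iff, (inl_injective Γ).mem_set_image, mem_proj_image_iff]
  exact or_iff_right (inl_ne_cuspPt Γ y i)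

/-- `π(σ_i w)` lies in every `cuspNhd i T` with `T < Im w`. [cite: ShimuraIATAF1971, §1.5] -/
theorem inl_proj_frameGL_smul_mem_cuspNhd (i : Fin (numCusps Γ)) {T : ℝ} {w : ℍ} (hw : T < w.im) :
    inl Γ (proj Γ (frameGL Γ i • w)) ∈ cuspNhd Γ i T :=
  (inl_mem_cuspNhd_iff Γ).2 ⟨w, hw, rfl⟩

/-- Membership of a cusp in a cusp neighbourhood. [cite: ShimuraIATAF1971, §1.5] -/
theorem cuspPt_mem_cuspNhd_iff {i j : Fin (numCusps Γ)} {T : ℝ} : cuspPt Γ j ∈ cuspNhd Γ i T ↔ j = i := by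
  rw [cuspNhd, mem_insert_iff, (cuspPt_injective Γ).eq_iff]
  constructor
  · rintro (h | ⟨y, -, h⟩)
    · exact h
    · exact absurd h (inl_ne_cuspPt Γ y j)
  · exact Or.inl

/-- For `T ≥ 1` the cusp neighbourhood is a basic open set of the `PunctureFill` topology. [cite: ShimuraIATAF1971, §1.5] -/
theorem cuspNhd_eq (i : Fin (numCusps Γ)) {T : ℝ} (hT : 1 ≤ T) :
    cuspNhd Γ i T = insert (cuspPt Γ i) (inl Γ '' (sector Γ i ∩ depth Γ ⁻¹' Iio (Real.exp (-T)))) := by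
  rw [cuspNhd, sector_inter_depth_lt Γ i hT]

/-- The cusp neighbourhoods `cuspNhd i T`, `T ≥ 1`, are open. [cite: ShimuraIATAF1971, §1.5 Thm. 1.28] -/
theorem isOpen_cuspNhd (i : Fin (numCusps Γ)) {T : ℝ} (hT : 1 ≤ T) : IsOpen (cuspNhd Γ i T) := by
  rw [cuspNhd_eq Γ i hT]
  exact PunctureFill.isOpen_cuspNhd i isOpen_Iio (by simp [Real.exp_pos])

/-- The cusp neighbourhoods shrink with `T`. [cite: ShimuraIATAF1971, §1.5] -/
theorem cuspNhd_mono (i : Fin (numCusps Γ)) {T T' : ℝ} (h : T ≤ T') : cuspNhd Γ i T' ⊆ cuspNhd Γ i T := by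
  refine insert_subset_insert (image_mono (image_mono (smul_set_mono ?_)))
  exact fun w hw => lt_of_le_of_lt h hw

/-- **The horoball neighbourhoods `cuspNhd i T`, `T ≥ 1`, form a basis of neighbourhoods of `cuspPt i`.**
[cite: ShimuraIATAF1971, §1.3 and §1.5 Thm. 1.28] [cite: DiamondShurman2005, §2.4 Prop. 2.4.4] -/
theorem nhds_cuspPt_hasBasis (i : Fin (numCusps Γ)) :
    (𝓝 (cuspPt Γ i)).HasBasis (fun T : ℝ => 1 ≤ T) fun T => cuspNhd Γ i T := by
  have hb := PunctureFill.nhds_inr_hasBasis (p := depth Γ) (x₀ := (0 : ℝ)) (U := sector Γ)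
    (continuous_depth Γ) (isOpen_sector Γ) i
  refine hb.to_hasBasis (fun O ⟨hO, hO0⟩ => ?_) fun T hT =>
    ⟨Iio (Real.exp (-T)), ⟨isOpen_Iio, by simp [Real.exp_pos]⟩, by rw [cuspNhd_eq Γ i hT]; exact Subset.rfl⟩
  -- an open `O ∋ 0` contains `(-ε, ε)`; take `T = max 1 (-log ε)`
  obtain ⟨ε, hε, hball⟩ := Metric.isOpen_iff.1 hO 0 hO0
  refine ⟨max 1 (-Real.log ε), le_max_left _ _, ?_⟩
  rw [cuspNhd_eq Γ i (le_max_left _ _)]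
  refine insert_subset_insert (image_mono fun y hy => ⟨hy.1, ?_⟩)
  have hlt : depth Γ y < Real.exp (-max 1 (-Real.log ε)) := hy.2
  refine hball ?_
  rw [Metric.mem_ball, dist_zero_right, Real.norm_eq_abs, abs_of_pos (show 0 < depth Γ y from Real.exp_pos _)]
  calc depth Γ y < Real.exp (-max 1 (-Real.log ε)) := hlt
    _ ≤ Real.exp (Real.log ε) := Real.exp_le_exp.2 (by linarith [le_max_right 1 (-Real.log ε)])
    _ = ε := Real.exp_log hε

/-- The cusp neighbourhoods are neighbourhoods. [cite: ShimuraIATAF1971, §1.5] -/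
theorem cuspNhd_mem_nhds (i : Fin (numCusps Γ)) {T : ℝ} (hT : 1 ≤ T) : cuspNhd Γ i T ∈ 𝓝 (cuspPt Γ i) :=
  (nhds_cuspPt_hasBasis Γ i).mem_of_mem hT

/-- **Continuity at a cusp.** A map `g` out of `X(Γ)` is continuous at `cuspPt i` iff `w ↦ g(π(σ_i w))` tends to
`g(cuspPt i)` as `Im w → ∞`. [cite: ShimuraIATAF1971, §1.5 Thm. 1.28] -/
theorem continuousAt_cuspPt_iff {Z : Type*} [TopologicalSpace Z] {g : Cpt Γ → Z} (i : Fin (numCusps Γ)) :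
    ContinuousAt g (cuspPt Γ i) ↔
      Tendsto (fun w : ℍ => g (inl Γ (proj Γ (frameGL Γ i • w)))) (comap UpperHalfPlane.im atTop) (𝓝 (g (cuspPt Γ i))) := by
  rw [ContinuousAt, (nhds_cuspPt_hasBasis Γ i).tendsto_left_iff]
  constructor
  · intro h
    rw [tendsto_iff_forall_eventually_mem]
    intro s hs
    obtain ⟨T, -, hT⟩ := h s hs
    have hev : ∀ᶠ w : ℍ in comap UpperHalfPlane.im atTop, T < w.im :=
      (tendsto_comap.eventually (eventually_gt_atTop T))
    exact hev.mono fun w hw => hT (inl_proj_frameGL_smul_mem_cuspNhd Γ i hw)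
  · intro h s hs
    have h' := h hs
    rw [mem_map, mem_comap] at h'
    obtain ⟨t, ht, hts⟩ := h'
    obtain ⟨T₀, hT₀⟩ := mem_atTop_sets.1 ht
    refine ⟨max 1 T₀, le_max_left _ _, ?_⟩
    rintro x hx
    rcases inl_or_cuspPt Γ x with ⟨y, rfl⟩ | ⟨j, rfl⟩
    · obtain ⟨w, hw, rfl⟩ := (inl_mem_cuspNhd_iff Γ).1 hx
      exact hts (hT₀ _ ((le_max_right _ _).trans hw.le))
    · rw [cuspPt_mem_cuspNhd_iff] at hx
      subst hx
      exact mem_of_mem_nhds hs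

/-! ### `X(Γ)` is Hausdorff -/

/-- Sectors of distinct cusps give disjoint cusp neighbourhoods (`T, T' ≥ 1`). [cite: ShimuraIATAF1971, §1.5 Lemma 1.20 and Thm. 1.28] -/
theorem disjoint_cuspNhd {i j : Fin (numCusps Γ)} (hij : i ≠ j) {T T' : ℝ} (hT : 1 ≤ T) (hT' : 1 ≤ T') :
    Disjoint (cuspNhd Γ i T) (cuspNhd Γ j T') := by
  refine disjoint_left.2 fun x hx hx' => ?_
  rcases inl_or_cuspPt Γ x with ⟨y, rfl⟩ | ⟨k, rfl⟩
  · obtain ⟨w, hw, hwy⟩ := (inl_mem_cuspNhd_iff Γ).1 hx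
    obtain ⟨w', hw', hw'y⟩ := (inl_mem_cuspNhd_iff Γ).1 hx'
    obtain ⟨γ, hγ, e⟩ := (proj_eq_iff Γ).1 (hw'y.trans hwy.symm)
    exact hij (ne_of_smul_frame_eq Γ (hT.trans_lt hw) (hT'.trans_lt hw') hγ e)
  · rw [cuspPt_mem_cuspNhd_iff] at hx hx'
    exact hij (hx.symm.trans hx')

/-- A point of height `< T` does not lie in `cuspNhd i T` (`T ≥ 1`). [cite: ShimuraIATAF1971, §1.5] -/
theorem inl_notMem_cuspNhd_of_heightQ_lt {i : Fin (numCusps Γ)} {T : ℝ} (hT : 1 ≤ T) {y : Quot Γ} (hy : heightQ Γ y < T) :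
    inl Γ y ∉ cuspNhd Γ i T := by
  intro h
  obtain ⟨w, hw, rfl⟩ := (inl_mem_cuspNhd_iff Γ).1 h
  rw [heightQ_proj, height_frameGL_smul Γ i (hT.trans hw.le)] at hy
  exact lt_asymm hw hy

/-- **`X(Γ)` is Hausdorff.** [cite: ShimuraIATAF1971, §1.5 Thm. 1.28] [cite: DiamondShurman2005, §2.4 Prop. 2.4.2] -/
instance instT2Space : T2Space (Cpt Γ) := by
  haveI : T2Space (Quot Γ) := t2Space_of_properlyDiscontinuousSMul_of_t2Space
  refine (t2Space_iff _).2 fun x x' hxx' => ?_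
  rcases inl_or_cuspPt Γ x with ⟨y, rfl⟩ | ⟨i, rfl⟩ <;> rcases inl_or_cuspPt Γ x' with ⟨y', rfl⟩ | ⟨i', rfl⟩
  · -- two old points
    have hyy' : y ≠ y' := fun h => hxx' (by rw [h])
    obtain ⟨u, v, hu, hv, hyu, hyv, huv⟩ := t2_separation hyy'
    exact ⟨inl Γ '' u, inl Γ '' v, (isOpenEmbedding_inl Γ).isOpenMap u hu, (isOpenEmbedding_inl Γ).isOpenMap v hv,
      mem_image_of_mem _ hyu, mem_image_of_mem _ hyv, (disjoint_image_iff (inl_injective Γ)).2 huv⟩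
  · -- old point, cusp
    set T : ℝ := max 1 (heightQ Γ y + 1) with hTdef
    refine ⟨inl Γ '' (heightQ Γ ⁻¹' Iio T), cuspNhd Γ i' T,
      (isOpenEmbedding_inl Γ).isOpenMap _ (isOpen_Iio.preimage (continuous_heightQ Γ)), isOpen_cuspNhd Γ i' (le_max_left _ _),
      mem_image_of_mem _ (by simp [hTdef]), cuspPt_mem_cuspNhd Γ _ _, disjoint_left.2 ?_⟩
    rintro _ ⟨s, hs, rfl⟩ hs'
    exact inl_notMem_cuspNhd_of_heightQ_lt Γ (le_max_left _ _) hs hs'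
  · -- cusp, old point
    set T : ℝ := max 1 (heightQ Γ y' + 1) with hTdef
    refine ⟨cuspNhd Γ i T, inl Γ '' (heightQ Γ ⁻¹' Iio T), isOpen_cuspNhd Γ i (le_max_left _ _),
      (isOpenEmbedding_inl Γ).isOpenMap _ (isOpen_Iio.preimage (continuous_heightQ Γ)),
      cuspPt_mem_cuspNhd Γ _ _, mem_image_of_mem _ (by simp [hTdef]), disjoint_left.2 ?_⟩
    rintro _ hs' ⟨s, hs, rfl⟩
    exact inl_notMem_cuspNhd_of_heightQ_lt Γ (le_max_left _ _) hs hs'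
  · -- two cusps
    have hii' : i ≠ i' := fun h => hxx' (by rw [h])
    exact ⟨cuspNhd Γ i 1, cuspNhd Γ i' 1, isOpen_cuspNhd Γ i le_rfl, isOpen_cuspNhd Γ i' le_rfl, cuspPt_mem_cuspNhd Γ _ _,
      cuspPt_mem_cuspNhd Γ _ _, disjoint_cuspNhd Γ hii' le_rfl le_rfl⟩

/-! ### `Y(Γ)` is dense in `X(Γ)`, which is connected -/

/-- **`Y(Γ)` is dense in `X(Γ)`** (every cusp neighbourhood contains points of its sector). [cite: ShimuraIATAF1971, §1.5] -/
theorem dense_range_inl : Dense (range (inl Γ)) := by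
  intro x
  rcases inl_or_cuspPt Γ x with ⟨y, rfl⟩ | ⟨i, rfl⟩
  · exact subset_closure (mem_range_self y)
  · rw [mem_closure_iff_nhds_basis (nhds_cuspPt_hasBasis Γ i)]
    intro T hT
    -- the point `σ_i (i(T+1))` of the sector
    refine ⟨inl Γ (proj Γ (frameGL Γ i • UpperHalfPlane.mk ((T + 1 : ℝ) * Complex.I) (by simp; linarith))), mem_range_self _, ?_⟩
    refine inl_proj_frameGL_smul_mem_cuspNhd Γ i ?_
    show T < (UpperHalfPlane.mk ((T + 1 : ℝ) * Complex.I) _).im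
    rw [UpperHalfPlane.im, UpperHalfPlane.coe_mk]
    simp

/-- **`X(Γ)` is connected** (`ℍ` is connected, so is its image `Y(Γ)`, which is dense). [cite: ShimuraIATAF1971, §1.5] -/
instance instConnectedSpace : ConnectedSpace (Cpt Γ) := by
  have hY : IsConnected (range (inl Γ)) := by
    have : range (inl Γ) = (inl Γ ∘ proj Γ) '' univ := by
      rw [image_univ, range_comp, (proj_surjective Γ).range_eq, image_univ]
    rw [this]
    exact isConnected_univ.image _ ((continuous_inl Γ).comp (continuous_proj Γ)).continuousOn
  have h := hY.closure
  rw [(dense_range_inl Γ).closure_eq] at h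
  exact connectedSpace_iff_univ.2 h

end ModularCurve

end Literature.NumberTheory.ModularForms

end
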